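import Summits.BirchSwinnertonDyer.Rank1Residual.SecondDescent.BSDpFromSecondDescentNonempty
import Summits.BirchSwinnertonDyer.Rank1Residual.Supersingular.RankZeroUpperBoundProp48
import Summits.BirchSwinnertonDyer.Rank1Residual.X11b.ChaPairsMinimality
import HarnessLib

/-!
# B-1 `NONEMPTY × 2` consumers at good supersingular `3` (X8 / X7 / X6, analytic rank 0) RE-BASED on Perrin-Riou 2003 Prop. 4.8 (Kato) — the refereed NUMBERED upper half in place of Wuthrich 2014 Prop. 21 — in both certificate currencies, class-level and for a literal model (cell `b2b-bsdres`, CLASS-CLOSURE instrument seat cc-eng-4, GEN 7)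

HONEST FRAMING (run/shared/lean/b2b/bsd-rank1-residual/, verbatim in every file): the goal of the
cell is to DELETE the COMBINATION-SHAPED residual classes of the Birch–Swinnerton-Dyer formula for
ALL analytic-rank `≤ 1` elliptic curves over `ℚ` — "full BSD formula for every rank `≤ 1` curve in
class `C`" assembled STRICTLY from published theorems — so that the rank-`≤ 1` remainder becomes
exactly the CONSTRUCTION-SHAPED classes, which are TYPED (missing-input `Prop`s), NOT attempted.
This is not "finishing BSD". Classes X6 / X7 / X8 stay CONSTRUCTION-SHAPED; everything here is PER
PAIR; per-curve second-descent outputs are INSTRUMENTATION (class-closure E4) / EVIDENCE under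
census-lead's tier label; no lane verdict is changed; no named fact is added; nothing is booked by
this unit (the lane books; the referee tiers the inputs, R-WU14-P21-SS). THEOREMS ONLY.

## Why
Every `NONEMPTY × 2` consumer of this directory (`SecondDescent/BSDpFromSecondDescentNonempty.lean`,
p289120 / p289561: `Ш` currency; `SecondDescent/NonemptyRecordsThree01.lean`, p297473: literal-model
shapes in both currencies) reads its UPPER half `ord₃ #Ш ≤ ord₃ #Ш_an` from Wuthrich 2014 Prop. 21
(`hW : sha_dvd_analyticSha`), whose supersingular clause the class lead of N6·O3 flagged as printed
without proof (R-WU14-P21-SS). Prover A of the supersingular family (x10b GEN 11,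
`Supersingular/RankZeroUpperBoundProp48.lean`) re-based the `Sel`-currency consumers on the refereed,
numbered **Perrin-Riou, Experiment. Math. 12 (2003) Prop. 4.8 (Kato)** (named fact
`PerrinRiou2003.prop48_padicValRat_bsd_rank_zero_le`, binder `h48`; Kato's image hypothesis (12.5.2)
automatic at good supersingular `3` from `surj(3)` — Wuthrich Lemma 20, PROVED in the tree — and
automatic on X6). This file does the same for the second-descent consumers, adding NOTHING else:
each theorem is the twin of a tree theorem with `hW` replaced by `h48` (same other binders).

## Contents
* §1 (`Ш` currency, class-level): `X8/X7.bsdp_three_rankZero_of_casselsTate_of_two_nonempty_of_prop48_of_surj`,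
  `X6.bsdp_three_rankZero_of_casselsTate_of_two_nonempty_of_prop48` — `#Ш[3] = 9` + two
  independent `3`-torsion classes of `Ш` BOTH third multiples + `ord₃ #Ш_an ≤ 4` ⇒ typed LOWER half
  (`missingLowerBoundAt_of_casselsTate_of_two_divisible`, p289120) ⇒ `BSD(E,3)` via
  `Supersingular.X*.bsdp_of_missingLowerBoundAt_of_prop48[_of_surj]`;
* §2 (literal model `⟨a₁,…,a₆⟩`, `IsElliptic` from `discOf ≠ 0`, minimality certificate `hmin`):
  the `Sel⁹`-currency shapes `X8/X7.bsdp_three_rankZero_of_ainvs_of_card_selmerNine_of_prop48_of_surj`,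
  `X6.bsdp_three_rankZero_of_ainvs_of_card_selmerNine_of_prop48` (wrapping x10b's
  `Supersingular.X*.bsdp_three_rankZero_of_card_selmerNine_of_prop48[_of_surj]`) and the
  `Ш`-currency shapes `X8/X7.bsdp_three_rankZero_of_ainvs_of_casselsTate_of_two_nonempty_of_prop48_of_surj`,
  `X6.bsdp_three_rankZero_of_ainvs_of_casselsTate_of_two_nonempty_of_prop48` (wrapping §1).
EVIDENCE pointers (targets; nothing run, nothing booked): additive-p3 GEN 19 `B1-ASK-SHA81` (X8 33 /
X7 11 / X6 3 = the N4@3 canary; staged `class-closure/eng-4/b1/production-staged-g5/` and `-g7/`).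
References: [PerrinRiou2003] Prop. 4.8 (p. 162); [Kato2004Asterisque] (12.5.2); [Wuthrich2014]
Lemma 20; [Serre1972] Props. 12, 21 i); [SilvermanAEC2009] X.4.2, X.4.14, VII.1; [Creutz2014] §1;
[Kraus1989]; [Miller2011LMS] Def. 1.1.
-/

set_option autoImplicit false

noncomputable section

open scoped Classical

open WeierstrassCurve Literature.NumberTheory.EllipticCurves
  Literature.NumberTheory.EllipticCurves.Rank1Residual
  Literature.NumberTheory.EllipticCurves.Rank1Residual.Typed
  Literature.NumberTheory.EllipticCurves.Rank1Residual.X11RankOneCertificates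
  Literature.NumberTheory.EllipticCurves.PerrinRiou2003
  Summit.BirchSwinnertonDyer.Rank1Residual.X11b

namespace Summit.BirchSwinnertonDyer.Rank1Residual.SecondDescent

/-! ### §1. `Ш` currency, class-level — upper half from Prop. 4.8 -/

/-- **X8 ∩ {r_an = 0} ∩ {surj(3)}, `ord₃ #Ш_an ≤ 4`: `BSD(E,3)` from PUBLISHED theorems + `#Ш[3] = 9`
+ TWO second-`3`-descent `NONEMPTY` witnesses on an `𝔽₃`-basis of `Ш[3]`, upper half from
Perrin-Riou 2003 Prop. 4.8** — the twin of `X8.bsdp_three_rankZero_of_casselsTate_of_two_nonempty_of_surj`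
(p289120) with `hW` replaced by `h48`. Per pair; class X8 unchanged; nothing booked.
[cite: PerrinRiou2003, Prop. 4.8 (p. 162)] [cite: Wuthrich2014, Lemma 20 (p. 399)]
[cite: SilvermanAEC2009, Thm. X.4.14] [cite: Creutz2014, §1] [cite: Miller2011LMS, §1 and Def. 1.1] -/
theorem X8.bsdp_three_rankZero_of_casselsTate_of_two_nonempty_of_prop48_of_surj
    (hCT : exists_casselsTate_pairing (K := ℚ)) (h48 : prop48_padicValRat_bsd_rank_zero_le)
    (hGZK : rank_eq_analyticRank_of_analyticRank_le_one) (hmod : hasEntireLFunction_rat)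
    (W : WeierstrassCurve ℚ) [W.IsElliptic] [W.IsGloballyMinimal] (hX : ClassX8 W 3) (hs : Surj W 3)
    (hr : W.analyticRank = 0) (hcard : Nat.card (AddSubgroup.torsionBy W.sha (3 : ℤ)) = 9)
    {c₁ c₂ d₁ d₂ : W.sha} (h1 : 3 • c₁ = 0) (h2 : 3 • c₂ = 0) (hc₁ : c₁ ≠ 0)
    (hind : c₂ ∉ AddSubgroup.zmultiples c₁) (hd₁ : 3 • d₁ = c₁) (hd₂ : 3 • d₂ = c₂)
    {q : ℚ} (hq : shaAn W = (q : ℂ)) (hv : padicValRat 3 q ≤ 4) : BSDp W 3 :=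
  Supersingular.X8.bsdp_of_missingLowerBoundAt_of_prop48_of_surj W 3 h48 hGZK hmod hX hs hr
    (missingLowerBoundAt_of_casselsTate_of_two_divisible W 3 hCT hGZK (by omega)
      (by rw [show ((3 : ℕ) : ℤ) = 3 by norm_num, hcard]; norm_num) h1 h2 hc₁ hind hd₁ hd₂ hq hv)

/-- **X7 ∩ {r_an = 0}, surj(3) (per-pair datum), `ord₃ #Ш_an ≤ 4`: `BSD(E,3)` from PUBLISHED
theorems + `#Ш[3] = 9` + TWO `NONEMPTY` witnesses, upper half from Prop. 4.8** — the twin of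
`X7.bsdp_three_rankZero_of_casselsTate_of_two_nonempty_of_surj` (p289561) with `hW` replaced by `h48`.
Per pair; class X7 unchanged; nothing booked. [cite: PerrinRiou2003, Prop. 4.8 (p. 162)]
[cite: Wuthrich2014, Lemma 20 (p. 399)] [cite: SilvermanAEC2009, Thm. X.4.14] [cite: Creutz2014, §1]
[cite: Miller2011LMS, §1 and Def. 1.1] -/
theorem X7.bsdp_three_rankZero_of_casselsTate_of_two_nonempty_of_prop48_of_surj
    (hCT : exists_casselsTate_pairing (K := ℚ)) (h48 : prop48_padicValRat_bsd_rank_zero_le)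
    (hGZK : rank_eq_analyticRank_of_analyticRank_le_one) (hmod : hasEntireLFunction_rat)
    (W : WeierstrassCurve ℚ) [W.IsElliptic] [W.IsGloballyMinimal] (hX : ClassX7 W 3) (hs : Surj W 3)
    (hr : W.analyticRank = 0) (hcard : Nat.card (AddSubgroup.torsionBy W.sha (3 : ℤ)) = 9)
    {c₁ c₂ d₁ d₂ : W.sha} (h1 : 3 • c₁ = 0) (h2 : 3 • c₂ = 0) (hc₁ : c₁ ≠ 0)
    (hind : c₂ ∉ AddSubgroup.zmultiples c₁) (hd₁ : 3 • d₁ = c₁) (hd₂ : 3 • d₂ = c₂)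
    {q : ℚ} (hq : shaAn W = (q : ℂ)) (hv : padicValRat 3 q ≤ 4) : BSDp W 3 :=
  Supersingular.X7.bsdp_of_missingLowerBoundAt_of_prop48_of_surj W 3 h48 hGZK hmod (by norm_num) hX hs
    hr
    (missingLowerBoundAt_of_casselsTate_of_two_divisible W 3 hCT hGZK (by omega)
      (by rw [show ((3 : ℕ) : ℤ) = 3 by norm_num, hcard]; norm_num) h1 h2 hc₁ hind hd₁ hd₂ hq hv)

/-- **X6 ∩ {r_an = 0}, `ord₃ #Ш_an ≤ 4`: `BSD(E,3)` from PUBLISHED theorems + `#Ш[3] = 9` + TWO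
`NONEMPTY` witnesses, upper half from Prop. 4.8, NO image binder** (X6: `ρ̄_{E,3}` onto is
automatic) — the twin of `X6.bsdp_three_rankZero_of_casselsTate_of_two_nonempty` (p289561) with
`hW` replaced by `h48`. EVIDENCE pointers: the N4@3 canary `152330l1 271726d1 405130d1`. Per pair;
class X6 unchanged; nothing booked. [cite: PerrinRiou2003, Prop. 4.8 (p. 162)]
[cite: Serre1972, §5.4 Prop. 21 i)] [cite: SilvermanAEC2009, Thm. X.4.14] [cite: Creutz2014, §1]
[cite: Miller2011LMS, §1 and Def. 1.1] -/
theorem X6.bsdp_three_rankZero_of_casselsTate_of_two_nonempty_of_prop48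
    (hCT : exists_casselsTate_pairing (K := ℚ)) (h48 : prop48_padicValRat_bsd_rank_zero_le)
    (hGZK : rank_eq_analyticRank_of_analyticRank_le_one) (hmod : hasEntireLFunction_rat)
    (W : WeierstrassCurve ℚ) [W.IsElliptic] [W.IsGloballyMinimal] (hX : ClassX6 W 3)
    (hr : W.analyticRank = 0) (hcard : Nat.card (AddSubgroup.torsionBy W.sha (3 : ℤ)) = 9)
    {c₁ c₂ d₁ d₂ : W.sha} (h1 : 3 • c₁ = 0) (h2 : 3 • c₂ = 0) (hc₁ : c₁ ≠ 0)
    (hind : c₂ ∉ AddSubgroup.zmultiples c₁) (hd₁ : 3 • d₁ = c₁) (hd₂ : 3 • d₂ = c₂)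
    {q : ℚ} (hq : shaAn W = (q : ℂ)) (hv : padicValRat 3 q ≤ 4) : BSDp W 3 :=
  Supersingular.X6.bsdp_of_missingLowerBoundAt_of_prop48 W 3 h48 hGZK hmod (by norm_num) hX hr
    (missingLowerBoundAt_of_casselsTate_of_two_divisible W 3 hCT hGZK (by omega)
      (by rw [show ((3 : ℕ) : ℤ) = 3 by norm_num, hcard]; norm_num) h1 h2 hc₁ hind hd₁ hd₂ hq hv)

/-! ### §2. Literal model `⟨a₁,…,a₆⟩` — both currencies, upper half from Prop. 4.8 -/

/-- **X8 ∩ {r_an = 0} ∩ {surj(3)}, literal model, `Sel⁹` currency, upper half from Prop. 4.8**: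
Cassels–Tate + `h48` + GZK + modularity + [X8 at `3`, `ρ̄_{E,3}` onto, `r_an = 0`, `ord₃ #Ш_an ≤ 4`]
+ `81 ∣ #Sel^(9)(E/ℚ)` ⟹ `BSD(E,3)` (`Supersingular.X8.bsdp_three_rankZero_of_card_selmerNine_of_prop48_of_surj`
with the instances manufactured from the literal data: `IsElliptic` from `discOf ≠ 0`,
`IsGloballyMinimal` = the certificate `hmin`). Per pair; class X8 unchanged; nothing booked.
[cite: PerrinRiou2003, Prop. 4.8 (p. 162)] [cite: Wuthrich2014, Lemma 20 (p. 399)]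
[cite: SilvermanAEC2009, Thm. X.4.2(a) and Thm. X.4.14] [cite: Miller2011LMS, §1 and Def. 1.1] -/
theorem X8.bsdp_three_rankZero_of_ainvs_of_card_selmerNine_of_prop48_of_surj
    (hCT : exists_casselsTate_pairing (K := ℚ)) (h48 : prop48_padicValRat_bsd_rank_zero_le)
    (hGZK : rank_eq_analyticRank_of_analyticRank_le_one) (hmod : hasEntireLFunction_rat)
    (a1 a2 a3 a4 a6 : ℤ) (hΔ : discOf [a1, a2, a3, a4, a6] ≠ 0)
    (hmin : (⟨a1, a2, a3, a4, a6⟩ : WeierstrassCurve ℚ).IsGloballyMinimal)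
    (hX : haveI := hmin; ClassX8 (⟨a1, a2, a3, a4, a6⟩ : WeierstrassCurve ℚ) 3)
    (hs : Surj (⟨a1, a2, a3, a4, a6⟩ : WeierstrassCurve ℚ) 3)
    (hr : (⟨a1, a2, a3, a4, a6⟩ : WeierstrassCurve ℚ).analyticRank = 0)
    {q : ℚ} (hq : shaAn (⟨a1, a2, a3, a4, a6⟩ : WeierstrassCurve ℚ) = (q : ℂ))
    (hv : padicValRat 3 q ≤ 4)
    (h81 : 81 ∣ Nat.card ((⟨a1, a2, a3, a4, a6⟩ : WeierstrassCurve ℚ).selmerGroup (9 : ℤ))) :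
    BSDp (⟨a1, a2, a3, a4, a6⟩ : WeierstrassCurve ℚ) 3 := by
  haveI := isElliptic_of_discOf_ne_zero a1 a2 a3 a4 a6 hΔ
  haveI := hmin
  exact Supersingular.X8.bsdp_three_rankZero_of_card_selmerNine_of_prop48_of_surj _ hCT h48 hGZK hmod
    hX hs hr hq hv h81

/-- **X7 ∩ {r_an = 0}, surj(3), literal model, `Sel⁹` currency, upper half from Prop. 4.8**
(`Supersingular.X7.bsdp_three_rankZero_of_card_selmerNine_of_prop48_of_surj` on the literal data).
Per pair; class X7 unchanged; nothing booked. [cite: PerrinRiou2003, Prop. 4.8 (p. 162)]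
[cite: Wuthrich2014, Lemma 20 (p. 399)] [cite: SilvermanAEC2009, Thm. X.4.2(a) and Thm. X.4.14]
[cite: Miller2011LMS, §1 and Def. 1.1] -/
theorem X7.bsdp_three_rankZero_of_ainvs_of_card_selmerNine_of_prop48_of_surj
    (hCT : exists_casselsTate_pairing (K := ℚ)) (h48 : prop48_padicValRat_bsd_rank_zero_le)
    (hGZK : rank_eq_analyticRank_of_analyticRank_le_one) (hmod : hasEntireLFunction_rat)
    (a1 a2 a3 a4 a6 : ℤ) (hΔ : discOf [a1, a2, a3, a4, a6] ≠ 0)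
    (hmin : (⟨a1, a2, a3, a4, a6⟩ : WeierstrassCurve ℚ).IsGloballyMinimal)
    (hX : haveI := hmin; ClassX7 (⟨a1, a2, a3, a4, a6⟩ : WeierstrassCurve ℚ) 3)
    (hs : Surj (⟨a1, a2, a3, a4, a6⟩ : WeierstrassCurve ℚ) 3)
    (hr : (⟨a1, a2, a3, a4, a6⟩ : WeierstrassCurve ℚ).analyticRank = 0)
    {q : ℚ} (hq : shaAn (⟨a1, a2, a3, a4, a6⟩ : WeierstrassCurve ℚ) = (q : ℂ))
    (hv : padicValRat 3 q ≤ 4)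
    (h81 : 81 ∣ Nat.card ((⟨a1, a2, a3, a4, a6⟩ : WeierstrassCurve ℚ).selmerGroup (9 : ℤ))) :
    BSDp (⟨a1, a2, a3, a4, a6⟩ : WeierstrassCurve ℚ) 3 := by
  haveI := isElliptic_of_discOf_ne_zero a1 a2 a3 a4 a6 hΔ
  haveI := hmin
  exact Supersingular.X7.bsdp_three_rankZero_of_card_selmerNine_of_prop48_of_surj _ hCT h48 hGZK hmod
    hX hs hr hq hv h81

/-- **X6 ∩ {r_an = 0}, literal model, `Sel⁹` currency, upper half from Prop. 4.8, NO image binder**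
(`Supersingular.X6.bsdp_three_rankZero_of_card_selmerNine_of_prop48` on the literal data). The shape
the N4@3 canary records would take with a refereed numbered upper half. Per pair; class X6 unchanged;
nothing booked. [cite: PerrinRiou2003, Prop. 4.8 (p. 162)] [cite: Serre1972, §5.4 Prop. 21 i)]
[cite: SilvermanAEC2009, Thm. X.4.2(a) and Thm. X.4.14] [cite: Miller2011LMS, §1 and Def. 1.1] -/
theorem X6.bsdp_three_rankZero_of_ainvs_of_card_selmerNine_of_prop48
    (hCT : exists_casselsTate_pairing (K := ℚ)) (h48 : prop48_padicValRat_bsd_rank_zero_le)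
    (hGZK : rank_eq_analyticRank_of_analyticRank_le_one) (hmod : hasEntireLFunction_rat)
    (a1 a2 a3 a4 a6 : ℤ) (hΔ : discOf [a1, a2, a3, a4, a6] ≠ 0)
    (hmin : (⟨a1, a2, a3, a4, a6⟩ : WeierstrassCurve ℚ).IsGloballyMinimal)
    (hX : haveI := hmin; ClassX6 (⟨a1, a2, a3, a4, a6⟩ : WeierstrassCurve ℚ) 3)
    (hr : (⟨a1, a2, a3, a4, a6⟩ : WeierstrassCurve ℚ).analyticRank = 0)
    {q : ℚ} (hq : shaAn (⟨a1, a2, a3, a4, a6⟩ : WeierstrassCurve ℚ) = (q : ℂ))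
    (hv : padicValRat 3 q ≤ 4)
    (h81 : 81 ∣ Nat.card ((⟨a1, a2, a3, a4, a6⟩ : WeierstrassCurve ℚ).selmerGroup (9 : ℤ))) :
    BSDp (⟨a1, a2, a3, a4, a6⟩ : WeierstrassCurve ℚ) 3 := by
  haveI := isElliptic_of_discOf_ne_zero a1 a2 a3 a4 a6 hΔ
  haveI := hmin
  exact Supersingular.X6.bsdp_three_rankZero_of_card_selmerNine_of_prop48 _ hCT h48 hGZK hmod hX hr
    hq hv h81

/-- **X8 ∩ {r_an = 0} ∩ {surj(3)}, literal model, `Ш` currency, upper half from Prop. 4.8**: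
`#Ш(E)[3] = 9` + two `3`-torsion classes `c₁ ≠ 0`, `c₂ ∉ ℤ∙c₁` of `Ш` BOTH third multiples +
`ord₃ #Ш_an ≤ 4` ⟹ `BSD(E,3)` (§1 on the literal data). Per pair; class X8 unchanged; nothing
booked. [cite: PerrinRiou2003, Prop. 4.8 (p. 162)] [cite: Wuthrich2014, Lemma 20 (p. 399)]
[cite: SilvermanAEC2009, Thm. X.4.14] [cite: Creutz2014, §1] [cite: Miller2011LMS, §1 and Def. 1.1] -/
theorem X8.bsdp_three_rankZero_of_ainvs_of_casselsTate_of_two_nonempty_of_prop48_of_surj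
    (hCT : exists_casselsTate_pairing (K := ℚ)) (h48 : prop48_padicValRat_bsd_rank_zero_le)
    (hGZK : rank_eq_analyticRank_of_analyticRank_le_one) (hmod : hasEntireLFunction_rat)
    (a1 a2 a3 a4 a6 : ℤ) (hΔ : discOf [a1, a2, a3, a4, a6] ≠ 0)
    (hmin : (⟨a1, a2, a3, a4, a6⟩ : WeierstrassCurve ℚ).IsGloballyMinimal)
    (hX : haveI := hmin; ClassX8 (⟨a1, a2, a3, a4, a6⟩ : WeierstrassCurve ℚ) 3)
    (hs : Surj (⟨a1, a2, a3, a4, a6⟩ : WeierstrassCurve ℚ) 3)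
    (hr : (⟨a1, a2, a3, a4, a6⟩ : WeierstrassCurve ℚ).analyticRank = 0)
    (hcard : Nat.card (AddSubgroup.torsionBy (⟨a1, a2, a3, a4, a6⟩ : WeierstrassCurve ℚ).sha (3 : ℤ))
      = 9)
    {c₁ c₂ d₁ d₂ : (⟨a1, a2, a3, a4, a6⟩ : WeierstrassCurve ℚ).sha} (h1 : 3 • c₁ = 0)
    (h2 : 3 • c₂ = 0) (hc₁ : c₁ ≠ 0) (hind : c₂ ∉ AddSubgroup.zmultiples c₁) (hd₁ : 3 • d₁ = c₁)
    (hd₂ : 3 • d₂ = c₂)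
    {q : ℚ} (hq : shaAn (⟨a1, a2, a3, a4, a6⟩ : WeierstrassCurve ℚ) = (q : ℂ))
    (hv : padicValRat 3 q ≤ 4) : BSDp (⟨a1, a2, a3, a4, a6⟩ : WeierstrassCurve ℚ) 3 := by
  haveI := isElliptic_of_discOf_ne_zero a1 a2 a3 a4 a6 hΔ
  haveI := hmin
  exact X8.bsdp_three_rankZero_of_casselsTate_of_two_nonempty_of_prop48_of_surj hCT h48 hGZK hmod _
    hX hs hr hcard h1 h2 hc₁ hind hd₁ hd₂ hq hv

/-- **X7 ∩ {r_an = 0}, surj(3), literal model, `Ш` currency, upper half from Prop. 4.8** (§1 on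
the literal data). Per pair; class X7 unchanged; nothing booked.
[cite: PerrinRiou2003, Prop. 4.8 (p. 162)] [cite: Wuthrich2014, Lemma 20 (p. 399)]
[cite: SilvermanAEC2009, Thm. X.4.14] [cite: Creutz2014, §1] [cite: Miller2011LMS, §1 and Def. 1.1] -/
theorem X7.bsdp_three_rankZero_of_ainvs_of_casselsTate_of_two_nonempty_of_prop48_of_surj
    (hCT : exists_casselsTate_pairing (K := ℚ)) (h48 : prop48_padicValRat_bsd_rank_zero_le)
    (hGZK : rank_eq_analyticRank_of_analyticRank_le_one) (hmod : hasEntireLFunction_rat)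
    (a1 a2 a3 a4 a6 : ℤ) (hΔ : discOf [a1, a2, a3, a4, a6] ≠ 0)
    (hmin : (⟨a1, a2, a3, a4, a6⟩ : WeierstrassCurve ℚ).IsGloballyMinimal)
    (hX : haveI := hmin; ClassX7 (⟨a1, a2, a3, a4, a6⟩ : WeierstrassCurve ℚ) 3)
    (hs : Surj (⟨a1, a2, a3, a4, a6⟩ : WeierstrassCurve ℚ) 3)
    (hr : (⟨a1, a2, a3, a4, a6⟩ : WeierstrassCurve ℚ).analyticRank = 0)
    (hcard : Nat.card (AddSubgroup.torsionBy (⟨a1, a2, a3, a4, a6⟩ : WeierstrassCurve ℚ).sha (3 : ℤ))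
      = 9)
    {c₁ c₂ d₁ d₂ : (⟨a1, a2, a3, a4, a6⟩ : WeierstrassCurve ℚ).sha} (h1 : 3 • c₁ = 0)
    (h2 : 3 • c₂ = 0) (hc₁ : c₁ ≠ 0) (hind : c₂ ∉ AddSubgroup.zmultiples c₁) (hd₁ : 3 • d₁ = c₁)
    (hd₂ : 3 • d₂ = c₂)
    {q : ℚ} (hq : shaAn (⟨a1, a2, a3, a4, a6⟩ : WeierstrassCurve ℚ) = (q : ℂ))
    (hv : padicValRat 3 q ≤ 4) : BSDp (⟨a1, a2, a3, a4, a6⟩ : WeierstrassCurve ℚ) 3 := by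
  haveI := isElliptic_of_discOf_ne_zero a1 a2 a3 a4 a6 hΔ
  haveI := hmin
  exact X7.bsdp_three_rankZero_of_casselsTate_of_two_nonempty_of_prop48_of_surj hCT h48 hGZK hmod _
    hX hs hr hcard h1 h2 hc₁ hind hd₁ hd₂ hq hv

/-- **X6 ∩ {r_an = 0}, literal model, `Ш` currency, upper half from Prop. 4.8, NO image binder**
(§1 on the literal data). EVIDENCE pointers: the N4@3 canary rows. Per pair; class X6 unchanged;
nothing booked. [cite: PerrinRiou2003, Prop. 4.8 (p. 162)] [cite: Serre1972, §5.4 Prop. 21 i)]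
[cite: SilvermanAEC2009, Thm. X.4.14] [cite: Creutz2014, §1] [cite: Miller2011LMS, §1 and Def. 1.1] -/
theorem X6.bsdp_three_rankZero_of_ainvs_of_casselsTate_of_two_nonempty_of_prop48
    (hCT : exists_casselsTate_pairing (K := ℚ)) (h48 : prop48_padicValRat_bsd_rank_zero_le)
    (hGZK : rank_eq_analyticRank_of_analyticRank_le_one) (hmod : hasEntireLFunction_rat)
    (a1 a2 a3 a4 a6 : ℤ) (hΔ : discOf [a1, a2, a3, a4, a6] ≠ 0)
    (hmin : (⟨a1, a2, a3, a4, a6⟩ : WeierstrassCurve ℚ).IsGloballyMinimal)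
    (hX : haveI := hmin; ClassX6 (⟨a1, a2, a3, a4, a6⟩ : WeierstrassCurve ℚ) 3)
    (hr : (⟨a1, a2, a3, a4, a6⟩ : WeierstrassCurve ℚ).analyticRank = 0)
    (hcard : Nat.card (AddSubgroup.torsionBy (⟨a1, a2, a3, a4, a6⟩ : WeierstrassCurve ℚ).sha (3 : ℤ))
      = 9)
    {c₁ c₂ d₁ d₂ : (⟨a1, a2, a3, a4, a6⟩ : WeierstrassCurve ℚ).sha} (h1 : 3 • c₁ = 0)
    (h2 : 3 • c₂ = 0) (hc₁ : c₁ ≠ 0) (hind : c₂ ∉ AddSubgroup.zmultiples c₁) (hd₁ : 3 • d₁ = c₁)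
    (hd₂ : 3 • d₂ = c₂)
    {q : ℚ} (hq : shaAn (⟨a1, a2, a3, a4, a6⟩ : WeierstrassCurve ℚ) = (q : ℂ))
    (hv : padicValRat 3 q ≤ 4) : BSDp (⟨a1, a2, a3, a4, a6⟩ : WeierstrassCurve ℚ) 3 := by
  haveI := isElliptic_of_discOf_ne_zero a1 a2 a3 a4 a6 hΔ
  haveI := hmin
  exact X6.bsdp_three_rankZero_of_casselsTate_of_two_nonempty_of_prop48 hCT h48 hGZK hmod _ hX hr
    hcard h1 h2 hc₁ hind hd₁ hd₂ hq hv


/-! ### §3. Appendix (cc-eng-4 GEN 11, 2026-08-21): `hcard`-FREE class-level forms of §1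

The binder `hcard : #Ш[3] = 9` of §1–§2 is NOT needed (`3⁴ ∣ #Ш` from the two witnesses alone:
`SecondDescent.missingLowerBoundAt_of_casselsTate_of_two_divisible'`, GEN 11 appendix of
`BSDpFromSecondDescentNonempty.lean`). The primed theorems below are §1's with `hcard` DELETED and
nothing else changed; the literal-model (`…_of_ainvs_…`) `hcard`-free shapes live in
`SecondDescent/NonemptyRecordShapesCardFree.lean`. Appended; decls above byte-identical; per pair;
classes unchanged; nothing booked.
-/

/-- **X8 ∩ {r_an = 0} ∩ {surj(3)}, `ord₃ #Ш_an ≤ 4`, upper half from Prop. 4.8: `BSD(E,3)` from TWO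
second-`3`-descent `NONEMPTY` witnesses — `hcard`-FREE** (= §1's X8 theorem without `#Ш[3] = 9`).
Per pair; class X8 unchanged; nothing booked; cc-eng-4 GEN 11. [cite: PerrinRiou2003, Prop. 4.8 (p. 162)]
[cite: Wuthrich2014, Lemma 20 (p. 399)] [cite: SilvermanAEC2009, Thm. X.4.14] [cite: Creutz2014, §1]
[cite: Miller2011LMS, §1 and Def. 1.1] -/
theorem X8.bsdp_three_rankZero_of_casselsTate_of_two_nonempty_of_prop48_of_surj'
    (hCT : exists_casselsTate_pairing (K := ℚ)) (h48 : prop48_padicValRat_bsd_rank_zero_le)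
    (hGZK : rank_eq_analyticRank_of_analyticRank_le_one) (hmod : hasEntireLFunction_rat)
    (W : WeierstrassCurve ℚ) [W.IsElliptic] [W.IsGloballyMinimal] (hX : ClassX8 W 3) (hs : Surj W 3)
    (hr : W.analyticRank = 0) {c₁ c₂ d₁ d₂ : W.sha} (h1 : 3 • c₁ = 0) (h2 : 3 • c₂ = 0)
    (hc₁ : c₁ ≠ 0) (hind : c₂ ∉ AddSubgroup.zmultiples c₁) (hd₁ : 3 • d₁ = c₁) (hd₂ : 3 • d₂ = c₂)
    {q : ℚ} (hq : shaAn W = (q : ℂ)) (hv : padicValRat 3 q ≤ 4) : BSDp W 3 :=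
  Supersingular.X8.bsdp_of_missingLowerBoundAt_of_prop48_of_surj W 3 h48 hGZK hmod hX hs hr
    (missingLowerBoundAt_of_casselsTate_of_two_divisible' W 3 hCT hGZK (by omega) h1 h2 hc₁ hind
      hd₁ hd₂ hq hv)

/-- **X7 ∩ {r_an = 0}, surj(3), `ord₃ #Ш_an ≤ 4`, upper half from Prop. 4.8: `BSD(E,3)` from TWO
`NONEMPTY` witnesses — `hcard`-FREE** (= §1's X7 theorem without `#Ш[3] = 9`). Per pair; class X7
unchanged; nothing booked; cc-eng-4 GEN 11. [cite: PerrinRiou2003, Prop. 4.8 (p. 162)]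
[cite: Wuthrich2014, Lemma 20 (p. 399)] [cite: SilvermanAEC2009, Thm. X.4.14] [cite: Creutz2014, §1]
[cite: Miller2011LMS, §1 and Def. 1.1] -/
theorem X7.bsdp_three_rankZero_of_casselsTate_of_two_nonempty_of_prop48_of_surj'
    (hCT : exists_casselsTate_pairing (K := ℚ)) (h48 : prop48_padicValRat_bsd_rank_zero_le)
    (hGZK : rank_eq_analyticRank_of_analyticRank_le_one) (hmod : hasEntireLFunction_rat)
    (W : WeierstrassCurve ℚ) [W.IsElliptic] [W.IsGloballyMinimal] (hX : ClassX7 W 3) (hs : Surj W 3)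
    (hr : W.analyticRank = 0) {c₁ c₂ d₁ d₂ : W.sha} (h1 : 3 • c₁ = 0) (h2 : 3 • c₂ = 0)
    (hc₁ : c₁ ≠ 0) (hind : c₂ ∉ AddSubgroup.zmultiples c₁) (hd₁ : 3 • d₁ = c₁) (hd₂ : 3 • d₂ = c₂)
    {q : ℚ} (hq : shaAn W = (q : ℂ)) (hv : padicValRat 3 q ≤ 4) : BSDp W 3 :=
  Supersingular.X7.bsdp_of_missingLowerBoundAt_of_prop48_of_surj W 3 h48 hGZK hmod (by norm_num) hX hs
    hr
    (missingLowerBoundAt_of_casselsTate_of_two_divisible' W 3 hCT hGZK (by omega) h1 h2 hc₁ hind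
      hd₁ hd₂ hq hv)

/-- **X6 ∩ {r_an = 0}, `ord₃ #Ш_an ≤ 4`, upper half from Prop. 4.8, NO image binder: `BSD(E,3)` from
TWO `NONEMPTY` witnesses — `hcard`-FREE** (= §1's X6 theorem without `#Ш[3] = 9`). EVIDENCE
pointers: the N4@3 canary `152330l1 271726d1 405130d1`. Per pair; class X6 unchanged; nothing
booked; cc-eng-4 GEN 11. [cite: PerrinRiou2003, Prop. 4.8 (p. 162)] [cite: Serre1972, §5.4 Prop. 21 i)]
[cite: SilvermanAEC2009, Thm. X.4.14] [cite: Creutz2014, §1] [cite: Miller2011LMS, §1 and Def. 1.1] -/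
theorem X6.bsdp_three_rankZero_of_casselsTate_of_two_nonempty_of_prop48'
    (hCT : exists_casselsTate_pairing (K := ℚ)) (h48 : prop48_padicValRat_bsd_rank_zero_le)
    (hGZK : rank_eq_analyticRank_of_analyticRank_le_one) (hmod : hasEntireLFunction_rat)
    (W : WeierstrassCurve ℚ) [W.IsElliptic] [W.IsGloballyMinimal] (hX : ClassX6 W 3)
    (hr : W.analyticRank = 0) {c₁ c₂ d₁ d₂ : W.sha} (h1 : 3 • c₁ = 0) (h2 : 3 • c₂ = 0)
    (hc₁ : c₁ ≠ 0) (hind : c₂ ∉ AddSubgroup.zmultiples c₁) (hd₁ : 3 • d₁ = c₁) (hd₂ : 3 • d₂ = c₂)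
    {q : ℚ} (hq : shaAn W = (q : ℂ)) (hv : padicValRat 3 q ≤ 4) : BSDp W 3 :=
  Supersingular.X6.bsdp_of_missingLowerBoundAt_of_prop48 W 3 h48 hGZK hmod (by norm_num) hX hr
    (missingLowerBoundAt_of_casselsTate_of_two_divisible' W 3 hCT hGZK (by omega) h1 h2 hc₁ hind
      hd₁ hd₂ hq hv)

end Summit.BirchSwinnertonDyer.Rank1Residual.SecondDescent

end
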